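import Summits.KontsevichZagierPeriods.KontsevichZagierPeriods.Theorems.HurwitzMicroSectorsNormalFormPrincipleLevelTwoMergeAndSwap
import Summits.KontsevichZagierPeriods.KontsevichZagierPeriods.Theorems.HurwitzMicroSectorsNormalFormPrincipleLevelTwoTriangleSubDimOne
import Summits.KontsevichZagierPeriods.KontsevichZagierPeriods.Theorems.HurwitzMicroSectorsNormalFormPrincipleLevelTwoDimOneNormalForm
import Summits.KontsevichZagierPeriods.KontsevichZagierPeriods.Theorems.HurwitzMicroSectorsNormalFormPrincipleLevelTwoExistsReps
import Summits.KontsevichZagierPeriods.KontsevichZagierPeriods.Theorems.HurwitzMicroSectorsNormalFormPrincipleAlgCarriers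
import Summits.KontsevichZagierPeriods.KontsevichZagierPeriods.Theorems.HurwitzMicroSectorsNormalFormPrincipleAlgSplitK5NormalForm
import Summits.KontsevichZagierPeriods.KontsevichZagierPeriods.Theorems.HurwitzMicroSectorsNormalFormPrincipleQuadNormalForm

/-!
# `NormalFormPrinciple` (stmt-KontsevichZagierPeriods-3869), line `SketchIdeator1` — leaf `stub_boxRigidity`:
# LEVEL TWO `[(0,1)², P/(1 − x²y²)]` WITH REAL-ALGEBRAIC COEFFICIENTS: the odd layer

The layer of boxes `[(0,1)², P(x,y)/(1 − x²y²)]`, `P ∈ (ℚ̄ ∩ ℝ)[x,y]`. A monomial `x^a y^b/(1 − x²y²)`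
has value `Σ_n 1/((2n+a+1)(2n+b+1))`, in `ℚ + ℚ·π²` when `a ≡ b (mod 2)` and in `ℚ + ℚ·log 2` when
`a + b` is odd; the two parts are treated separately (a joint statement would need the `ℚ̄`-linear
independence of `1, π², log 2`, which is open). THIS FILE: the ODD part. Every odd monomial box
reduces inside `FormalRep ⧸ relations`, by the Kontsevich–Zagier rules only, to the dlog normal form
`Λ(2, γ) + [pt, q]` of the tree's `AlgSplitK5` calculus (`Λ(2, γ) = [(1,2), γ/y]`, value `γ log 2`;
`γ, q` real algebraic): merge `u = xy` to the triangle `{0<x<1, 0≤u≤x}` with integrand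
`c x^{a−b−1} u^b/(1 − u²)` (`levelTwo_merge_and_swap`, rule 2), integrate out `x`
(`levelTwo_triangle_sub_dimOne`, rule 3) to `[(0,1), (c/(a−b)) u^b Σ_{i<a−b} u^i/(1+u)]`, and split
`u^j/(1+u) = u^{j−1} − u^{j−1}/(1+u)` down to points and the carrier (`levelTwo_dimOne_normalForm`,
rules 1, 2, 3). Sums and polynomials by integrand additivity and the closure properties of the normal
form. On the subgroup of `FormalRep` generated by the odd level-two boxes, the carriers `Λ(2, γ)` and
the algebraic points every element therefore has the normal form `Λ(2, γ) + [pt, q]`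
(`exists_nf_of_mem_oddClosure`); its value `γ log 2 + q` is rigid in the algebraic data (Baker /
Hermite–Lindemann: `log 2 ∉ ℚ̄`, through the tree's `AlgSplitK5.mem_relations_of_nf_of_eval_eq_zero`),
so value `0` forces a relation: CONJECTURE 1 OF KONTSEVICH–ZAGIER HOLDS ON THE ODD LEVEL-TWO LAYER
UNCONDITIONALLY (`levelTwoOdd_mem_relations_of_eval_eq_zero_of_mem_closure`); e.g.
`∫∫_{(0,1)²} y dxdy/(1−x²y²) = log 2` against `∫_1^2 dy/y` (`oddBox_equivalent_dlogTwo_of_value_eq`).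
References: M. Kontsevich, D. Zagier, *Periods* (2001), §1.2; A. Baker, *Transcendental Number Theory*
(1975), Thm. 2.1 (as landed in the tree). No new definitions.
-/

noncomputable section

open MeasureTheory Set
open Literature.NumberTheory.Transcendental Literature.NumberTheory.Transcendental.KZ
open Literature.ModelTheory.ExponentialFields (IsSemialgebraic)

namespace Summit.KontsevichZagierPeriods.HurwitzMicroSectors.NormalFormPrinciple.PiBox.AlgLevelTwo

open Summit.KontsevichZagierPeriods.HurwitzMicroSectors.NormalFormPrinciple.PiBox.Dlog
  (pt_zero_mem_relations pt_congr_mem_relations exists_ptCarrierA exists_dlogA isAlgebraic_two)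
open Summit.KontsevichZagierPeriods.HurwitzMicroSectors.NormalFormPrinciple.PiBox.AlgSplitK5
  (nf_add nf_neg nf_congr nf_of_mem_relations nf_pt nf_carrier mem_relations_of_nf_of_eval_eq_zero)

/-- `0 < 1 − x²y²` on the open unit box. [folklore] -/
theorem one_sub_sq_mul_sq_pos_of_mem_box {x : Fin 2 → ℝ} (hx : x ∈ {x : Fin 2 → ℝ | ∀ i, x i ∈ Set.Ioo (0:ℝ) 1}) :
    0 < 1 - x 0 ^ 2 * x 1 ^ 2 := by
  have h0 := hx 0
  have h1 := hx 1
  simp only [Set.mem_Ioo] at h0 h1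
  have ha : x 0 ^ 2 < 1 := by nlinarith
  have hb : x 1 ^ 2 ≤ 1 := by nlinarith
  nlinarith [sq_nonneg (x 0), sq_nonneg (x 1)]

/-- **Odd part, `b < a`**: the monomial box `[(0,1)², c x^a y^b/(1 − x²y²)]`, `a + b` odd, is in the
dlog normal form `Λ(2, γ) + [pt, q]` with `γ, q` real algebraic (merge → triangle → dimension one →
`Λ(2,γ) = [(1,2), γ/y]` plus points). [cite: KontsevichZagier2001, §1.2] -/
theorem odd_monomial_nf_of_lt (c : ℝ) (hc : IsAlgebraic ℚ c) (a b : ℕ) (hab : b < a)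
    (N : IntegralRep 2) (hNd : N.domain = {x | ∀ i, x i ∈ Set.Ioo (0:ℝ) 1})
    (hNi : EqOn N.integrand (fun x => c * (x 0 ^ a * x 1 ^ b) / (1 - x 0 ^ 2 * x 1 ^ 2)) N.domain) :
    ∃ (r : ℝ) (C : Fin 1 → ℝ) (Z : IntegralRep 0) (L : Fin 1 → IntegralRep 1),
      IsAlgebraic ℚ r ∧ (∀ i, IsAlgebraic ℚ (C i)) ∧ Z.domain = Set.univ ∧ (Z.integrand = fun _ => r) ∧
      (∀ i, (L i).domain = {x : Fin 1 → ℝ | x 0 ∈ Set.Ioo (1:ℝ) 2} ∧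
        ((L i).integrand = fun x => C i / x 0)) ∧
      of N - of Z - ∑ i, of (L i) ∈ relations := by
  obtain ⟨-, hexR, hexN₁⟩ := levelTwo_exists_reps c hc
  obtain ⟨Zf, hZf⟩ := exists_ptCarrierA
  obtain ⟨R, hRd, hRi⟩ := hexR a b hab
  obtain ⟨N₁, hN₁d, hN₁i⟩ := hexN₁ b (a - b)
  have e1 := (levelTwo_merge_and_swap a b c hc).1 hab N R hNd hNi hRd (hRi ▸ fun _ _ => rfl)
  have e2 := levelTwo_triangle_sub_dimOne a b c hc hab R N₁ hRd (hRi ▸ fun _ _ => rfl) hN₁d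
    (hN₁i ▸ fun _ _ => rfl)
  obtain ⟨γ, q, hγ, hq, h3⟩ := (levelTwo_dimOne_normalForm c hc).1 b (a - b) (Nat.sub_pos_of_lt hab)
    N₁ hN₁d (hN₁i ▸ fun _ _ => rfl)
  obtain ⟨L₀, hL₀d, hL₀i⟩ := exists_dlogA isAlgebraic_one isAlgebraic_two hγ one_pos
  refine ⟨q, fun _ => γ, Zf q, fun _ => L₀, hq, fun _ => hγ, (hZf q hq).1, (hZf q hq).2,
    fun _ => ⟨hL₀d, hL₀i⟩, ?_⟩
  have e3 := h3 L₀ (Zf q) hL₀d hL₀i (hZf q hq).1 (hZf q hq).2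
  simp only [Fin.sum_univ_one]
  have e : of N - of (Zf q) - of L₀ = (of N - of R) + (of R - of N₁) + (of N₁ - of L₀ - of (Zf q)) := by
    abel
  rw [e]
  exact relations.add_mem (relations.add_mem e1 e2) e3

/-- **Dlog normal form of an ODD monomial box `[(0,1)², c x^a y^b/(1 − x²y²)]`, `a + b` odd, with an
algebraic coefficient**: `Λ(2, γ) + [pt, q]`, `γ, q ∈ ℚ̄ ∩ ℝ` (the normal form `NF((2), ·)` of the
tree's `AlgSplitK5` calculus). [cite: KontsevichZagier2001, §1.2] -/
theorem levelTwo_monomial_nf_odd (c : ℝ) (hc : IsAlgebraic ℚ c) (a b : ℕ) (hodd : Odd (a + b))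
    (N : IntegralRep 2) (hNd : N.domain = {x | ∀ i, x i ∈ Set.Ioo (0:ℝ) 1})
    (hNi : EqOn N.integrand (fun x => c * (x 0 ^ a * x 1 ^ b) / (1 - x 0 ^ 2 * x 1 ^ 2)) N.domain) :
    ∃ (r : ℝ) (C : Fin 1 → ℝ) (Z : IntegralRep 0) (L : Fin 1 → IntegralRep 1),
      IsAlgebraic ℚ r ∧ (∀ i, IsAlgebraic ℚ (C i)) ∧ Z.domain = Set.univ ∧ (Z.integrand = fun _ => r) ∧
      (∀ i, (L i).domain = {x : Fin 1 → ℝ | x 0 ∈ Set.Ioo (1:ℝ) 2} ∧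
        ((L i).integrand = fun x => C i / x 0)) ∧
      of N - of Z - ∑ i, of (L i) ∈ relations := by
  rcases lt_trichotomy b a with hab | rfl | hab
  · exact odd_monomial_nf_of_lt c hc a b hab N hNd hNi
  · exfalso
    obtain ⟨m, hm⟩ := hodd
    omega
  · obtain ⟨hexN, -, -⟩ := levelTwo_exists_reps c hc
    obtain ⟨N', hN'd, hN'i⟩ := hexN b a
    have e0 := (levelTwo_merge_and_swap a b c hc).2 N N' hNd hNi hN'd (hN'i ▸ fun _ _ => rfl)
    have h := odd_monomial_nf_of_lt c hc b a hab N' hN'd (hN'i ▸ fun _ _ => rfl)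
    exact nf_congr (ε := fun _ : Fin 1 => (2:ℝ)) h e0

/-- **Existence of the level-two representation** `[(0,1)², (Σ_{s∈S} c_s x^{s₀}y^{s₁})/(1 − x²y²)]`
for real-algebraic coefficients. [cite: KontsevichZagier2001, §1.1] -/
theorem exists_levelTwoRep (S : Finset (Fin 2 →₀ ℕ)) (coef : (Fin 2 →₀ ℕ) → ℝ)
    (halg : ∀ s ∈ S, IsAlgebraic ℚ (coef s)) :
    ∃ N : IntegralRep 2, N.domain = {x | ∀ i, x i ∈ Set.Ioo (0:ℝ) 1} ∧
      N.integrand = fun x => (∑ s ∈ S, coef s * (x 0 ^ (s 0) * x 1 ^ (s 1))) / (1 - x 0 ^ 2 * x 1 ^ 2) := by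
  classical
  induction S using Finset.induction_on with
  | empty =>
    obtain ⟨N, hNd, hNi⟩ := (levelTwo_exists_reps 0 isAlgebraic_zero).1 0 0
    refine ⟨N, hNd, ?_⟩
    rw [hNi]
    funext x
    simp
  | insert s S hs ih =>
    obtain ⟨N₁, hN₁d, hN₁i⟩ := ih fun t ht => halg t (Finset.mem_insert_of_mem ht)
    obtain ⟨N₂, hN₂d, hN₂i⟩ :=
      (levelTwo_exists_reps (coef s) (halg s (Finset.mem_insert_self s S))).1 (s 0) (s 1)
    refine ⟨⟨N₁.domain, fun x => (∑ t ∈ insert s S, coef t * (x 0 ^ (t 0) * x 1 ^ (t 1))) /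
        (1 - x 0 ^ 2 * x 1 ^ 2), N₁.isSemialgebraic_domain, ?_, ?_⟩, hN₁d, rfl⟩
    · refine (IsSemialgebraicFunOn.add_holds (hN₂d.trans hN₁d.symm ▸ N₂.isSemialgebraicFunOn_integrand)
        N₁.isSemialgebraicFunOn_integrand).congr fun x _ => ?_
      rw [hN₁i, hN₂i]
      simp only [Pi.add_apply, Finset.sum_insert hs]
      ring
    · have h := ((hN₂d.trans hN₁d.symm) ▸ N₂.integrableOn).add N₁.integrableOn
      refine h.congr_fun (fun x _ => ?_) (IntegralRep.measurableSet_domain_holds N₁)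
      rw [hN₁i, hN₂i]
      simp only [Pi.add_apply, Finset.sum_insert hs]
      ring

/-- **Odd sums**: dlog normal form of `[(0,1)², (Σ_{s∈S} c_s x^s)/(1 − x²y²)]`, all `s₀ + s₁` odd.
[cite: KontsevichZagier2001, §1.2] -/
theorem odd_sum_nf (coef : (Fin 2 →₀ ℕ) → ℝ) : ∀ (S : Finset (Fin 2 →₀ ℕ)),
    (∀ s ∈ S, IsAlgebraic ℚ (coef s)) → (∀ s ∈ S, Odd (s 0 + s 1)) → ∀ (N : IntegralRep 2),
    N.domain = {x | ∀ i, x i ∈ Set.Ioo (0:ℝ) 1} →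
    EqOn N.integrand
      (fun x => (∑ s ∈ S, coef s * (x 0 ^ (s 0) * x 1 ^ (s 1))) / (1 - x 0 ^ 2 * x 1 ^ 2)) N.domain →
    ∃ (r : ℝ) (C : Fin 1 → ℝ) (Z : IntegralRep 0) (L : Fin 1 → IntegralRep 1),
      IsAlgebraic ℚ r ∧ (∀ i, IsAlgebraic ℚ (C i)) ∧ Z.domain = Set.univ ∧ (Z.integrand = fun _ => r) ∧
      (∀ i, (L i).domain = {x : Fin 1 → ℝ | x 0 ∈ Set.Ioo (1:ℝ) 2} ∧
        ((L i).integrand = fun x => C i / x 0)) ∧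
      of N - of Z - ∑ i, of (L i) ∈ relations := by
  classical
  have h2alg : ∀ _i : Fin 1, IsAlgebraic ℚ ((fun _ : Fin 1 => (2:ℝ)) _i) := fun _ => isAlgebraic_two
  intro S
  induction S using Finset.induction_on with
  | empty =>
    intro _ _ N hNd hNi
    have hN : of N ∈ relations := of_mem_relations_of_eqOn_zero N fun x hx => by rw [hNi hx]; simp
    exact nf_of_mem_relations (ε := fun _ : Fin 1 => (2:ℝ)) h2alg hN
  | insert s S hs ih =>
    intro halg hpar N hNd hNi
    have halgS : ∀ t ∈ S, IsAlgebraic ℚ (coef t) := fun t ht => halg t (Finset.mem_insert_of_mem ht)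
    have hparS : ∀ t ∈ S, Odd (t 0 + t 1) := fun t ht => hpar t (Finset.mem_insert_of_mem ht)
    have halgs : IsAlgebraic ℚ (coef s) := halg s (Finset.mem_insert_self s S)
    obtain ⟨N₁, hN₁d, hN₁i⟩ := exists_levelTwoRep S coef halgS
    obtain ⟨N₂, hN₂d, hN₂i⟩ := (levelTwo_exists_reps (coef s) halgs).1 (s 0) (s 1)
    have h₁ := ih halgS hparS N₁ hN₁d (hN₁i ▸ fun _ _ => rfl)
    have h₂ := levelTwo_monomial_nf_odd (coef s) halgs (s 0) (s 1)
      (hpar s (Finset.mem_insert_self s S)) N₂ hN₂d (hN₂i ▸ fun _ _ => rfl)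
    have eN : of N - of N₂ - of N₁ ∈ relations := by
      refine integrandAddRel_subset_relations ⟨2, N, N₂, N₁, hN₂d.trans hNd.symm, hN₁d.trans hNd.symm,
        fun x hx => ?_, rfl⟩
      rw [Pi.add_apply, hNi hx, hN₁i, hN₂i]
      simp only [Finset.sum_insert hs]
      ring
    have h12 := nf_add (ε := fun _ : Fin 1 => (2:ℝ)) h2alg h₂ h₁
    refine nf_congr (ε := fun _ : Fin 1 => (2:ℝ)) h12 ?_
    have e : of N - (of N₂ + of N₁) = of N - of N₂ - of N₁ := by abel
    rwa [e]

/-! ## The odd layer: Conjecture 1, kernel form, via the dlog normal form and Baker -/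

/-- **Dlog normal form of an odd level-two box** `[(0,1)², P/(1 − x²y²)]`, `P ∈ (ℚ̄ ∩ ℝ)[x,y]` with only
monomials of odd total degree. [cite: KontsevichZagier2001, §1.2] -/
theorem levelTwo_nf_odd (P : MvPolynomial (Fin 2) ℝ) (hP : ∀ s, IsAlgebraic ℚ (P.coeff s))
    (hodd : ∀ s ∈ P.support, Odd (s 0 + s 1)) (N : IntegralRep 2)
    (hNd : N.domain = {x | ∀ i, x i ∈ Set.Ioo (0:ℝ) 1})
    (hNi : EqOn N.integrand (fun x => MvPolynomial.eval x P / (1 - x 0 ^ 2 * x 1 ^ 2)) N.domain) :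
    ∃ (r : ℝ) (C : Fin 1 → ℝ) (Z : IntegralRep 0) (L : Fin 1 → IntegralRep 1),
      IsAlgebraic ℚ r ∧ (∀ i, IsAlgebraic ℚ (C i)) ∧ Z.domain = Set.univ ∧ (Z.integrand = fun _ => r) ∧
      (∀ i, (L i).domain = {x : Fin 1 → ℝ | x 0 ∈ Set.Ioo (1:ℝ) 2} ∧
        ((L i).integrand = fun x => C i / x 0)) ∧
      of N - of Z - ∑ i, of (L i) ∈ relations :=
  odd_sum_nf P.coeff P.support (fun s _ => hP s) hodd N hNd fun x hx => by
    rw [hNi hx]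
    beta_reduce
    rw [MvPolynomial.eval_eq]
    congr 1
    refine Finset.sum_congr rfl fun s _ => ?_
    congr 1
    change s.prod (fun i n => x i ^ n) = _
    rw [Finsupp.prod_fintype _ _ (fun i => pow_zero _), Fin.prod_univ_two]

/-- `log 2`, as a family indexed by `Fin 1`, is `ℚ`-linearly independent (`log 2 ≠ 0`). [folklore] -/
theorem linearIndependent_log_two :
    LinearIndependent ℚ (fun i : Fin 1 => Real.log ((fun _ : Fin 1 => (2:ℝ)) i)) :=
  linearIndependent_unique_iff.2 (Real.log_pos one_lt_two).ne'

/-- **Dlog normal forms on the subgroup** generated by the odd level-two boxes, the carriers `Λ(2, γ)`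
and the algebraic points (closure properties of the tree's `AlgSplitK5` normal form).
[cite: KontsevichZagier2001, §1.2] -/
theorem exists_nf_of_mem_oddClosure {x : FormalRep}
    (hx : x ∈ AddSubgroup.closure
      ({y : FormalRep | ∃ (P : MvPolynomial (Fin 2) ℝ) (N : IntegralRep 2),
          (∀ s, IsAlgebraic ℚ (P.coeff s)) ∧ (∀ s ∈ P.support, Odd (s 0 + s 1)) ∧
          N.domain = {x | ∀ i, x i ∈ Set.Ioo (0:ℝ) 1} ∧
          EqOn N.integrand (fun x => MvPolynomial.eval x P / (1 - x 0 ^ 2 * x 1 ^ 2)) N.domain ∧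
          y = of N} ∪
       {y : FormalRep | ∃ (γ : ℝ) (L : IntegralRep 1), IsAlgebraic ℚ γ ∧
          L.domain = {x : Fin 1 → ℝ | x 0 ∈ Set.Ioo (1:ℝ) 2} ∧ (L.integrand = fun x => γ / x 0) ∧
          y = of L} ∪
       {y : FormalRep | ∃ (r : ℝ) (Z : IntegralRep 0), IsAlgebraic ℚ r ∧ Z.domain = Set.univ ∧
          (Z.integrand = fun _ => r) ∧ y = of Z})) :
    ∃ (r : ℝ) (C : Fin 1 → ℝ) (Z : IntegralRep 0) (L : Fin 1 → IntegralRep 1),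
      IsAlgebraic ℚ r ∧ (∀ i, IsAlgebraic ℚ (C i)) ∧ Z.domain = Set.univ ∧ (Z.integrand = fun _ => r) ∧
      (∀ i, (L i).domain = {x : Fin 1 → ℝ | x 0 ∈ Set.Ioo (1:ℝ) 2} ∧
        ((L i).integrand = fun x => C i / x 0)) ∧
      x - of Z - ∑ i, of (L i) ∈ relations := by
  have h2alg : ∀ i : Fin 1, IsAlgebraic ℚ ((fun _ : Fin 1 => (2:ℝ)) i) := fun _ => isAlgebraic_two
  induction hx using AddSubgroup.closure_induction with
  | mem y hy =>
    rcases hy with (hy | hy) | hy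
    · obtain ⟨P, N, hP, hodd, hNd, hNi, rfl⟩ := hy
      exact levelTwo_nf_odd P hP hodd N hNd hNi
    · obtain ⟨γ, L, hγ, hLd, hLi, rfl⟩ := hy
      exact nf_carrier (ε := fun _ : Fin 1 => (2:ℝ)) h2alg hγ 0 L hLd hLi
    · obtain ⟨r, Z, hr, hZd, hZi, rfl⟩ := hy
      exact nf_pt (ε := fun _ : Fin 1 => (2:ℝ)) h2alg hr Z hZd hZi
  | zero => exact nf_of_mem_relations (ε := fun _ : Fin 1 => (2:ℝ)) h2alg (zero_mem _)
  | add y z _ _ ihy ihz => exact nf_add (ε := fun _ : Fin 1 => (2:ℝ)) h2alg ihy ihz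
  | neg y _ ihy => exact nf_neg (ε := fun _ : Fin 1 => (2:ℝ)) h2alg ihy

/-- **Conjecture 1 of Kontsevich–Zagier, kernel form, for the ODD LEVEL-TWO LAYER** — unconditionally:
a formal `ℤ`-combination of boxes `[(0,1)², P/(1 − x²y²)]` (`P ∈ (ℚ̄ ∩ ℝ)[x,y]` with monomials of odd
total degree only; values in `ℚ̄ + ℚ̄·log 2`), of dlog carriers `Λ(2, γ) = [(1,2), γ/y]` and of
algebraic points, with value `0`, is a relation. Normal form `Λ(2, γ) + [pt, q]`, value
`γ log 2 + q`, rigid by Baker's theorem as used in the tree's `AlgSplitK5` calculus (here only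
`log 2 ∉ ℚ̄`, Hermite–Lindemann). [cite: KontsevichZagier2001, §1.2 Conjecture 1] -/
theorem levelTwoOdd_mem_relations_of_eval_eq_zero_of_mem_closure {x : FormalRep}
    (hx : x ∈ AddSubgroup.closure
      ({y : FormalRep | ∃ (P : MvPolynomial (Fin 2) ℝ) (N : IntegralRep 2),
          (∀ s, IsAlgebraic ℚ (P.coeff s)) ∧ (∀ s ∈ P.support, Odd (s 0 + s 1)) ∧
          N.domain = {x | ∀ i, x i ∈ Set.Ioo (0:ℝ) 1} ∧
          EqOn N.integrand (fun x => MvPolynomial.eval x P / (1 - x 0 ^ 2 * x 1 ^ 2)) N.domain ∧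
          y = of N} ∪
       {y : FormalRep | ∃ (γ : ℝ) (L : IntegralRep 1), IsAlgebraic ℚ γ ∧
          L.domain = {x : Fin 1 → ℝ | x 0 ∈ Set.Ioo (1:ℝ) 2} ∧ (L.integrand = fun x => γ / x 0) ∧
          y = of L} ∪
       {y : FormalRep | ∃ (r : ℝ) (Z : IntegralRep 0), IsAlgebraic ℚ r ∧ Z.domain = Set.univ ∧
          (Z.integrand = fun _ => r) ∧ y = of Z}))
    (hv : eval x = 0) : x ∈ relations :=
  mem_relations_of_nf_of_eval_eq_zero (ε := fun _ : Fin 1 => (2:ℝ)) (fun _ => one_lt_two)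
    (fun _ => isAlgebraic_two) linearIndependent_log_two (exists_nf_of_mem_oddClosure hx) hv

/-- **Two odd level-two boxes with equal values are KZ-equivalent** (unconditionally).
[cite: KontsevichZagier2001, §1.2 Conjecture 1] -/
theorem levelTwoOdd_equivalent_of_value_eq (N N' : IntegralRep 2) (P P' : MvPolynomial (Fin 2) ℝ)
    (hP : ∀ s, IsAlgebraic ℚ (P.coeff s)) (hodd : ∀ s ∈ P.support, Odd (s 0 + s 1))
    (hP' : ∀ s, IsAlgebraic ℚ (P'.coeff s)) (hodd' : ∀ s ∈ P'.support, Odd (s 0 + s 1))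
    (hNd : N.domain = {x | ∀ i, x i ∈ Set.Ioo (0:ℝ) 1})
    (hNi : EqOn N.integrand (fun x => MvPolynomial.eval x P / (1 - x 0 ^ 2 * x 1 ^ 2)) N.domain)
    (hN'd : N'.domain = {x | ∀ i, x i ∈ Set.Ioo (0:ℝ) 1})
    (hN'i : EqOn N'.integrand (fun x => MvPolynomial.eval x P' / (1 - x 0 ^ 2 * x 1 ^ 2)) N'.domain)
    (hv : N.value = N'.value) : Equivalent N N' := by
  refine levelTwoOdd_mem_relations_of_eval_eq_zero_of_mem_closure (AddSubgroup.sub_mem _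
    (AddSubgroup.subset_closure (Or.inl (Or.inl ⟨P, N, hP, hodd, hNd, hNi, rfl⟩)))
    (AddSubgroup.subset_closure (Or.inl (Or.inl ⟨P', N', hP', hodd', hN'd, hN'i, rfl⟩)))) ?_
  rw [map_sub, eval_of, eval_of, hv, sub_self]

/-- Evaluation of a monomial in two variables. [folklore] -/
theorem eval_monomial_two (s : Fin 2 →₀ ℕ) (c : ℝ) (x : Fin 2 → ℝ) :
    MvPolynomial.eval x (MvPolynomial.monomial s c) = c * (x 0 ^ (s 0) * x 1 ^ (s 1)) := by
  rw [MvPolynomial.eval_monomial]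
  congr 1
  rw [Finsupp.prod_fintype _ _ (fun i => pow_zero _), Fin.prod_univ_two]

/-- A monomial box `[(0,1)², c x^a y^b/(1 − x²y²)]` with algebraic `c` and `a + b` odd is a generator of
the odd layer. [cite: KontsevichZagier2001, §1.2] -/
theorem monomialBox_mem_oddGenerators (c : ℝ) (hc : IsAlgebraic ℚ c) (a b : ℕ) (hodd : Odd (a + b))
    (N : IntegralRep 2) (hNd : N.domain = {x | ∀ i, x i ∈ Set.Ioo (0:ℝ) 1})
    (hNi : EqOn N.integrand (fun x => c * (x 0 ^ a * x 1 ^ b) / (1 - x 0 ^ 2 * x 1 ^ 2)) N.domain) :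
    ∃ (P : MvPolynomial (Fin 2) ℝ) (N' : IntegralRep 2),
      (∀ s, IsAlgebraic ℚ (P.coeff s)) ∧ (∀ s ∈ P.support, Odd (s 0 + s 1)) ∧
      N'.domain = {x | ∀ i, x i ∈ Set.Ioo (0:ℝ) 1} ∧
      EqOn N'.integrand (fun x => MvPolynomial.eval x P / (1 - x 0 ^ 2 * x 1 ^ 2)) N'.domain ∧
      of N = of N' := by
  classical
  refine ⟨MvPolynomial.monomial (Finsupp.single 0 a + Finsupp.single 1 b) c, N, fun s => ?_,
    fun s hs => ?_, hNd, fun x hx => ?_, rfl⟩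
  · rw [MvPolynomial.coeff_monomial]
    split_ifs
    · exact hc
    · exact isAlgebraic_zero
  · have hs' := MvPolynomial.support_monomial_subset hs
    rw [Finset.mem_singleton] at hs'
    subst hs'
    simpa [Finsupp.add_apply] using hodd
  · rw [hNi hx]
    beta_reduce
    rw [eval_monomial_two]
    simp [Finsupp.add_apply]

/-- **`∫∫_{(0,1)²} c·y/(1 − x²y²) dxdy` against the dlog carrier `Λ(2, γ)`** (values `c log 2`, `γ log 2`):
equal values imply KZ-equivalence, unconditionally. [cite: KontsevichZagier2001, §1.2 Conjecture 1] -/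
theorem oddBox_equivalent_dlogTwo_of_value_eq (c γ : ℝ) (hc : IsAlgebraic ℚ c) (hγ : IsAlgebraic ℚ γ)
    (N : IntegralRep 2) (L : IntegralRep 1) (hNd : N.domain = {x | ∀ i, x i ∈ Set.Ioo (0:ℝ) 1})
    (hNi : EqOn N.integrand (fun x => c * x 1 / (1 - x 0 ^ 2 * x 1 ^ 2)) N.domain)
    (hLd : L.domain = {x : Fin 1 → ℝ | x 0 ∈ Set.Ioo (1:ℝ) 2}) (hLi : L.integrand = fun x => γ / x 0)
    (hv : N.value = L.value) : Equivalent N L := by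
  obtain ⟨P, N', hP, hodd, hN'd, hN'i, hNN'⟩ := monomialBox_mem_oddGenerators c hc 0 1 (by decide) N hNd
    (fun x hx => by rw [hNi hx]; simp)
  refine levelTwoOdd_mem_relations_of_eval_eq_zero_of_mem_closure (AddSubgroup.sub_mem _
    (AddSubgroup.subset_closure (Or.inl (Or.inl ⟨P, N', hP, hodd, hN'd, hN'i, hNN'⟩)))
    (AddSubgroup.subset_closure (Or.inl (Or.inr ⟨γ, L, hγ, hLd, hLi, rfl⟩)))) ?_
  rw [map_sub, eval_of, eval_of, hv, sub_self]

end Summit.KontsevichZagierPeriods.HurwitzMicroSectors.NormalFormPrinciple.PiBox.AlgLevelTwo
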